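import Summits.CriticalPhenomena.Ising3DConformalLimit.Theorems.MoebiusLimitExists.Negative.ReflectionWord
import Summits.CriticalPhenomena.Ising3DConformalLimit.Theorems.MoebiusLimitExists.Negative.InversionRadial
import Literature.Probability.LatticeModels.HighDimPointwiseTriviality

/-!
# `MoebiusLimit` (item stmt-CriticalPhenomena-1344): ROTATION INVARIANCE FOLLOWS FROM INVERSION COVARIANCE

Structural knowledge about the crux `…Theses.EnergyNotSigmaSquared.MoebiusLimit`
(= `PerfectScreening.MoebiusLimitExists`), standing crux disprover (D-0016); THEOREM-ONLY, no
Ising input. For a family `S` on `ℝ³` which is translation invariant, scale covariant and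
inversion covariant with the same `Δ`, with symmetric non-degenerate two-point function:

* `inversion_covariant_general` — covariance under the inversion in ANY sphere
  (`ι_{c,r} = T_c ∘ D_{r²} ∘ ι ∘ T_{−c}`), with per-point factor `(r²)^{−Δ}‖z − c‖^{2Δ}`;
* `reflection_chain` — along the word `R_{m^⊥} = ι_m ι_{m/2,1/2} ι_m` (`ReflectionWord.lean`),
  `S_n(R ∘ x) = (∏ᵢ φ(xᵢ)) S_n(x)` for configurations avoiding the poles `±m`;
* `reflection_factor_eq_one` — the per-point factor is `1`: calibrate on pairs, using the radial
  (hence `R`-invariant) two-point function supplied by `InversionRadial.lean`;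
* `reflection_invariant`, `isRotationInvariant_of_inversion` — hence `S_n(R ∘ x) = S_n(x)` for every
  reflection (translate the configuration off the poles first) and, reflections generating `O(3)`
  (Cartan–Dieudonné, `LinearIsometryEquiv.reflections_generate_dim`), FULL `O(3)` INVARIANCE.
So among the Möbius generators the unit inversion alone carries all the symmetry content of the
crux: with the free lattice translations and the automatic dilations, `IsRotationInvariant` is a
CONSEQUENCE of `IsInversionCovariant` (corollary for the crux in `CruxInversionOnly.lean`).
-/

noncomputable section

namespace Summit.CriticalPhenomena.Ising3DConformalLimit.MoebiusLimitExistsNegative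

open Literature.Probability.LatticeModels EuclideanGeometry RealInnerProductSpace
open scoped RealInnerProductSpace

variable {Δ : ℝ} {S : CorrFamily 3}

/-! ### Inversion in a general sphere -/

/-- `ι_{c,r}(p) = r²·ι(p − c) + c` with `ι` the unit inversion at the origin. [folklore] -/
theorem inversion_eq_smul_inversion_origin (c : EuclideanSpace ℝ (Fin 3)) (r : ℝ)
    (p : EuclideanSpace ℝ (Fin 3)) :
    inversion c r p = (r ^ 2) • inversion 0 1 (p - c) + c := by
  rw [inversion_eq_center_add, inversion_origin_apply, smul_smul, add_comm, div_eq_mul_one_div]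

/-- **Covariance under the inversion in any sphere**, from translation invariance, scale
covariance and unit-inversion covariance (same `Δ`): per-point factor `(r²)^{−Δ}‖zᵢ − c‖^{2Δ}`.
[cite: FrancescoMathieuSenechal1997, §4.1 eq. (4.15)] -/
theorem inversion_covariant_general (htr : IsTranslationInvariant S) (hsc : IsScaleCovariant Δ S)
    (hinv : IsInversionCovariant Δ S) (c : EuclideanSpace ℝ (Fin 3)) {r : ℝ} (hr : 0 < r) {n : ℕ}
    (z : Fin n → EuclideanSpace ℝ (Fin 3)) (hz : ∀ i, z i ≠ c) :
    S n (fun i => inversion c r (z i)) = (∏ i, ((r ^ 2) ^ (-Δ) * ‖z i - c‖ ^ (2 * Δ))) * S n z := by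
  have h1 : (fun i => inversion c r (z i)) = fun i => (r ^ 2) • inversion 0 1 (z i - c) + c :=
    funext fun i => inversion_eq_smul_inversion_origin c r (z i)
  have h2 := htr n c (fun i => (r ^ 2) • inversion 0 1 (z i - c))
  have h3 := hsc n (r ^ 2) (by positivity) (fun i => inversion 0 1 (z i - c))
  have h4 := hinv n (fun i => z i - c) (fun i => sub_ne_zero.2 (hz i))
  have h5 : S n (fun i => z i - c) = S n z := by
    have := htr n (-c) z
    simp only [← sub_eq_add_neg] at this
    exact this
  rw [h1, h2, h3, h4, h5, Finset.prod_mul_distrib, Finset.prod_const, Finset.card_univ, Fintype.card_fin,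
    ← Real.rpow_natCast ((r ^ 2) ^ (-Δ)) n, ← Real.rpow_mul (sq_nonneg r)]
  rw [show (-Δ * (n:ℝ)) = -(n:ℝ) * Δ by ring]
  ring

/-! ### The reflection in `m^⊥` along the inversion word -/

/-- **Covariance along the word** `R_{m^⊥} = ι_m ι_{m/2,1/2} ι_m` for configurations avoiding the
poles `±m`: `S_n(R ∘ x) = (∏ᵢ φ(xᵢ)) S_n(x)` with the explicit positive per-point factor `φ`.
[folklore] -/
theorem reflection_chain (htr : IsTranslationInvariant S) (hsc : IsScaleCovariant Δ S)
    (hinv : IsInversionCovariant Δ S) {m : EuclideanSpace ℝ (Fin 3)} (hm : ‖m‖ = 1) {n : ℕ}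
    (x : Fin n → EuclideanSpace ℝ (Fin 3)) (hx : ∀ i, x i ≠ m ∧ x i ≠ -m) :
    S n (fun i => x i - (2 * ⟪x i, m⟫) • m) =
      (∏ i, (‖x i - m‖ ^ (2 * Δ) *
        ((((1 / 2 : ℝ) ^ 2) ^ (-Δ) * ‖inversion m 1 (x i) - (1 / 2 : ℝ) • m‖ ^ (2 * Δ)) *
          ‖inversion ((1 / 2 : ℝ) • m) (1 / 2) (inversion m 1 (x i)) - m‖ ^ (2 * Δ)))) * S n x := by
  have hw : (fun i => x i - (2 * ⟪x i, m⟫) • m) =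
      fun i => inversion m 1 (inversion ((1 / 2 : ℝ) • m) (1 / 2) (inversion m 1 (x i))) :=
    funext fun i => reflection_eq_inversion_word hm (hx i).1 (hx i).2
  have h3 := inversion_covariant_general htr hsc hinv m one_pos
    (fun i => inversion ((1 / 2 : ℝ) • m) (1 / 2) (inversion m 1 (x i)))
    (fun i => inversion_half_ne_center hm (hx i).1)
  have h2 := inversion_covariant_general htr hsc hinv ((1 / 2 : ℝ) • m) (by norm_num : (0:ℝ) < 1 / 2)
    (fun i => inversion m 1 (x i)) (fun i => inversion_unit_ne_half hm (hx i).2)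
  have h1 := inversion_covariant_general htr hsc hinv m one_pos x (fun i => (hx i).1)
  rw [hw, h3, h2, h1, ← mul_assoc, ← mul_assoc, ← Finset.prod_mul_distrib, ← Finset.prod_mul_distrib]
  congr 1
  refine Finset.prod_congr rfl fun i _ => ?_
  simp only [one_pow, Real.one_rpow, one_mul]
  ring

/-- The per-point factor of the reflection word. Stated through a defining hypothesis to keep
statements readable (`hφ`). It is positive off the poles. [folklore] -/
theorem reflection_factor_pos {m : EuclideanSpace ℝ (Fin 3)} (hm : ‖m‖ = 1) {φ : EuclideanSpace ℝ (Fin 3) → ℝ}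
    (hφ : ∀ p, φ p = ‖p - m‖ ^ (2 * Δ) *
        ((((1 / 2 : ℝ) ^ 2) ^ (-Δ) * ‖inversion m 1 p - (1 / 2 : ℝ) • m‖ ^ (2 * Δ)) *
          ‖inversion ((1 / 2 : ℝ) • m) (1 / 2) (inversion m 1 p) - m‖ ^ (2 * Δ)))
    {p : EuclideanSpace ℝ (Fin 3)} (hp : p ≠ m ∧ p ≠ -m) : 0 < φ p := by
  rw [hφ]
  have h1 : 0 < ‖p - m‖ := norm_pos_iff.2 (sub_ne_zero.2 hp.1)
  have h2 : 0 < ‖inversion m 1 p - (1 / 2 : ℝ) • m‖ :=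
    norm_pos_iff.2 (sub_ne_zero.2 (inversion_unit_ne_half hm hp.2))
  have h3 : 0 < ‖inversion ((1 / 2 : ℝ) • m) (1 / 2) (inversion m 1 p) - m‖ :=
    norm_pos_iff.2 (sub_ne_zero.2 (inversion_half_ne_center hm hp.1))
  have h4 : 0 < ((1 / 2 : ℝ) ^ 2) ^ (-Δ) := Real.rpow_pos_of_pos (by norm_num) _
  have := Real.rpow_pos_of_pos h1 (2 * Δ)
  have := Real.rpow_pos_of_pos h2 (2 * Δ)
  have := Real.rpow_pos_of_pos h3 (2 * Δ)
  positivity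

/-- The reflection in `v^⊥` as a linear isometry: `(ℝ∙v)ᗮ.reflection p = p − (2⟪p,v⟫/‖v‖²) v`
(any `v`; for `v = 0` both sides are `p`). [folklore] -/
theorem reflection_orthogonal_span_apply (v p : EuclideanSpace ℝ (Fin 3)) :
    (ℝ ∙ v)ᗮ.reflection p = p - (2 * ⟪p, v⟫ / ‖v‖ ^ 2) • v := by
  rw [Submodule.reflection_orthogonal_apply, Submodule.reflection_apply,
    Submodule.starProjection_singleton (𝕜 := ℝ), real_inner_comm]
  simp only [RCLike.ofReal_real_eq_id, id_eq, two_smul]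
  module

/-- For a unit vector: `(ℝ∙m)ᗮ.reflection p = p − 2⟪p,m⟫ m`. [folklore] -/
theorem reflection_orthogonal_singleton_apply {m : EuclideanSpace ℝ (Fin 3)} (hm : ‖m‖ = 1)
    (p : EuclideanSpace ℝ (Fin 3)) :
    (ℝ ∙ m)ᗮ.reflection p = p - (2 * ⟪p, m⟫) • m := by
  rw [reflection_orthogonal_span_apply, hm, one_pow, div_one]

/-- Scalar multiples of a unit vector are injective in the scalar. [folklore] -/
theorem smul_unit_ne {m : EuclideanSpace ℝ (Fin 3)} (hm : ‖m‖ = 1) {a b : ℝ} (hab : a ≠ b) :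
    a • m ≠ b • m := by
  have hm0 : m ≠ 0 := by
    intro h; rw [h, norm_zero] at hm; exact zero_ne_one hm
  exact fun h => hab (smul_left_injective ℝ hm0 h)

/-- **Calibration: the per-point factor is `1`.** On pairs the chain reads
`S₂(Rp, Rq) = φ(p)φ(q) S₂(p,q)`, while the radial two-point function of `InversionRadial.lean` is
`R`-invariant and positive; three mutually distinct points finish. [folklore] -/
theorem reflection_factor_eq_one (htr : IsTranslationInvariant S) (hsc : IsScaleCovariant Δ S)
    (hinv : IsInversionCovariant Δ S)
    (hsym : ∀ p q : EuclideanSpace ℝ (Fin 3), p ≠ q → S 2 ![p, q] = S 2 ![q, p])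
    (hnd : IsNondegenerateTwoPoint S) {m : EuclideanSpace ℝ (Fin 3)} (hm : ‖m‖ = 1)
    {φ : EuclideanSpace ℝ (Fin 3) → ℝ}
    (hφ : ∀ p, φ p = ‖p - m‖ ^ (2 * Δ) *
        ((((1 / 2 : ℝ) ^ 2) ^ (-Δ) * ‖inversion m 1 p - (1 / 2 : ℝ) • m‖ ^ (2 * Δ)) *
          ‖inversion ((1 / 2 : ℝ) • m) (1 / 2) (inversion m 1 p) - m‖ ^ (2 * Δ)))
    {p : EuclideanSpace ℝ (Fin 3)} (hp : p ≠ m ∧ p ≠ -m) : φ p = 1 := by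
  -- the pair identity
  have hpair : ∀ a b : EuclideanSpace ℝ (Fin 3), a ≠ b → (a ≠ m ∧ a ≠ -m) → (b ≠ m ∧ b ≠ -m) →
      φ a * φ b = 1 := by
    intro a b hab ha hb
    have hchain := reflection_chain htr hsc hinv hm ![a, b] (by intro i; fin_cases i <;> assumption)
    have hcfg : (fun i => (![a, b] : Fin 2 → EuclideanSpace ℝ (Fin 3)) i -
        (2 * ⟪(![a, b] : Fin 2 → EuclideanSpace ℝ (Fin 3)) i, m⟫) • m) =
        ![(ℝ ∙ m)ᗮ.reflection a, (ℝ ∙ m)ᗮ.reflection b] := by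
      funext i; fin_cases i <;> simp [reflection_orthogonal_singleton_apply hm]
    rw [hcfg, two_point_isometry_of_inversion htr hsc hinv hsym _ hab, Fin.prod_univ_two] at hchain
    simp only [Matrix.cons_val_zero, Matrix.cons_val_one, Matrix.cons_val_fin_one, ← hφ] at hchain
    have hpos : 0 < S 2 ![a, b] := hnd _ (pair_mem_nonCoincident hab)
    have : (1 - φ a * φ b) * S 2 ![a, b] = 0 := by linarith
    rcases mul_eq_zero.1 this with h0 | h0
    · linarith
    · exact absurd h0 hpos.ne'
  -- three auxiliary points off the poles: `0`, `2m`, `3m`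
  have h0m : ((0 : EuclideanSpace ℝ (Fin 3)) ≠ m ∧ (0 : EuclideanSpace ℝ (Fin 3)) ≠ -m) := by
    constructor
    · intro h; rw [← h, norm_zero] at hm; exact zero_ne_one hm
    · intro h; rw [zero_eq_neg] at h; rw [h, norm_zero] at hm; exact zero_ne_one hm
  have h2m : ((2:ℝ) • m ≠ m ∧ (2:ℝ) • m ≠ -m) := by
    constructor
    · have := smul_unit_ne hm (by norm_num : (2:ℝ) ≠ 1); rwa [one_smul] at this
    · have := smul_unit_ne hm (by norm_num : (2:ℝ) ≠ -1); rwa [neg_one_smul] at this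
  have h3m : ((3:ℝ) • m ≠ m ∧ (3:ℝ) • m ≠ -m) := by
    constructor
    · have := smul_unit_ne hm (by norm_num : (3:ℝ) ≠ 1); rwa [one_smul] at this
    · have := smul_unit_ne hm (by norm_num : (3:ℝ) ≠ -1); rwa [neg_one_smul] at this
  have h02 : (0 : EuclideanSpace ℝ (Fin 3)) ≠ (2:ℝ) • m := by
    have := smul_unit_ne hm (by norm_num : (0:ℝ) ≠ 2); rwa [zero_smul] at this
  have h03 : (0 : EuclideanSpace ℝ (Fin 3)) ≠ (3:ℝ) • m := by
    have := smul_unit_ne hm (by norm_num : (0:ℝ) ≠ 3); rwa [zero_smul] at this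
  have h23 : (2:ℝ) • m ≠ (3:ℝ) • m := smul_unit_ne hm (by norm_num)
  have hφp : 0 < φ p := reflection_factor_pos hm hφ hp
  -- pick two auxiliary points distinct from `p`
  have key : ∀ q₁ q₂ : EuclideanSpace ℝ (Fin 3), p ≠ q₁ → p ≠ q₂ → q₁ ≠ q₂ →
      (q₁ ≠ m ∧ q₁ ≠ -m) → (q₂ ≠ m ∧ q₂ ≠ -m) → φ p = 1 := by
    intro q₁ q₂ hp1 hp2 h12 hq1 hq2
    have e1 := hpair p q₁ hp1 hp hq1
    have e2 := hpair p q₂ hp2 hp hq2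
    have e3 := hpair q₁ q₂ h12 hq1 hq2
    have hq1p : 0 < φ q₁ := reflection_factor_pos hm hφ hq1
    have hsq : φ p * φ p = 1 := by
      have : (φ p * φ q₁) * (φ p * φ q₂) = φ p * φ p * (φ q₁ * φ q₂) := by ring
      rw [e1, e2, e3, one_mul, mul_one] at this
      exact this.symm
    nlinarith
  by_cases hp0 : p = 0
  · subst hp0
    exact key _ _ h02 h03 h23 h2m h3m
  by_cases hp2 : p = (2:ℝ) • m
  · subst hp2
    exact key _ _ (Ne.symm h02) h23 h03 h0m h3m
  · exact key _ _ hp0 hp2 h02 h0m h2m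

/-- **Reflection invariance off the poles.** [folklore] -/
theorem reflection_invariant_of_ne (htr : IsTranslationInvariant S) (hsc : IsScaleCovariant Δ S)
    (hinv : IsInversionCovariant Δ S)
    (hsym : ∀ p q : EuclideanSpace ℝ (Fin 3), p ≠ q → S 2 ![p, q] = S 2 ![q, p])
    (hnd : IsNondegenerateTwoPoint S) {m : EuclideanSpace ℝ (Fin 3)} (hm : ‖m‖ = 1) {n : ℕ}
    (x : Fin n → EuclideanSpace ℝ (Fin 3)) (hx : ∀ i, x i ≠ m ∧ x i ≠ -m) :
    S n (fun i => x i - (2 * ⟪x i, m⟫) • m) = S n x := by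
  rw [reflection_chain htr hsc hinv hm x hx]
  have hone : ∀ i, (‖x i - m‖ ^ (2 * Δ) *
        ((((1 / 2 : ℝ) ^ 2) ^ (-Δ) * ‖inversion m 1 (x i) - (1 / 2 : ℝ) • m‖ ^ (2 * Δ)) *
          ‖inversion ((1 / 2 : ℝ) • m) (1 / 2) (inversion m 1 (x i)) - m‖ ^ (2 * Δ))) = 1 :=
    fun i => reflection_factor_eq_one htr hsc hinv hsym hnd hm (φ := fun p => ‖p - m‖ ^ (2 * Δ) *
        ((((1 / 2 : ℝ) ^ 2) ^ (-Δ) * ‖inversion m 1 p - (1 / 2 : ℝ) • m‖ ^ (2 * Δ)) *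
          ‖inversion ((1 / 2 : ℝ) • m) (1 / 2) (inversion m 1 p) - m‖ ^ (2 * Δ)))
      (fun _ => rfl) (hx i)
  rw [Finset.prod_eq_one fun i _ => hone i, one_mul]

/-- **Every reflection in a plane through the origin leaves `S` invariant** (all configurations:
translate off the poles first — translations are free). [folklore] -/
theorem reflection_invariant (htr : IsTranslationInvariant S) (hsc : IsScaleCovariant Δ S)
    (hinv : IsInversionCovariant Δ S)
    (hsym : ∀ p q : EuclideanSpace ℝ (Fin 3), p ≠ q → S 2 ![p, q] = S 2 ![q, p])
    (hnd : IsNondegenerateTwoPoint S) {m : EuclideanSpace ℝ (Fin 3)} (hm : ‖m‖ = 1) (n : ℕ)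
    (x : Fin n → EuclideanSpace ℝ (Fin 3)) :
    S n (fun i => x i - (2 * ⟪x i, m⟫) • m) = S n x := by
  -- a translation along `m` taking the configuration off the poles
  have hmm : ⟪m, m⟫ = 1 := by rw [real_inner_self_eq_norm_sq, hm]; norm_num
  obtain ⟨t, ht⟩ : ∃ t : ℝ, ∀ i, x i + t • m ≠ m ∧ x i + t • m ≠ -m := by
    classical
    obtain ⟨t, ht⟩ := Infinite.exists_notMem_finset
      ((Finset.univ.image fun i : Fin n => ⟪m - x i, m⟫) ∪ (Finset.univ.image fun i : Fin n => ⟪-m - x i, m⟫))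
    refine ⟨t, fun i => ⟨?_, ?_⟩⟩
    · intro h
      apply ht
      rw [Finset.mem_union, Finset.mem_image]
      left
      refine ⟨i, Finset.mem_univ _, ?_⟩
      have e : t • m = m - x i := eq_sub_iff_add_eq.2 (by rw [add_comm]; exact h)
      rw [← e, real_inner_smul_left, hmm, mul_one]
    · intro h
      apply ht
      rw [Finset.mem_union, Finset.mem_image, Finset.mem_image]
      right
      refine ⟨i, Finset.mem_univ _, ?_⟩
      have e : t • m = -m - x i := eq_sub_iff_add_eq.2 (by rw [add_comm]; exact h)
      rw [← e, real_inner_smul_left, hmm, mul_one]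
  -- the reflection formula is additive
  set v : EuclideanSpace ℝ (Fin 3) := t • m with hv
  have hcfg : (fun i => x i - (2 * ⟪x i, m⟫) • m) =
      fun i => ((x i + v) - (2 * ⟪x i + v, m⟫) • m) + (-(v - (2 * ⟪v, m⟫) • m)) := by
    funext i
    rw [inner_add_left]
    module
  rw [hcfg, htr n (-(v - (2 * ⟪v, m⟫) • m)) (fun i => (x i + v) - (2 * ⟪x i + v, m⟫) • m),
    reflection_invariant_of_ne htr hsc hinv hsym hnd hm (fun i => x i + v) ht, htr n v x]

/-- **`O(3)` INVARIANCE FROM INVERSION COVARIANCE**: a translation-invariant, scale- and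
inversion-covariant (same `Δ`) family with symmetric non-degenerate two-point function is invariant
under every linear isometry of `ℝ³` (reflections generate `O(3)`, Cartan–Dieudonné).
[cite: FrancescoMathieuSenechal1997, §4.1 eqs. (4.13)–(4.19)] -/
theorem isRotationInvariant_of_inversion (htr : IsTranslationInvariant S) (hsc : IsScaleCovariant Δ S)
    (hinv : IsInversionCovariant Δ S)
    (hsym : ∀ p q : EuclideanSpace ℝ (Fin 3), p ≠ q → S 2 ![p, q] = S 2 ![q, p])
    (hnd : IsNondegenerateTwoPoint S) : IsRotationInvariant S := by
  -- one reflection in a hyperplane `(ℝ∙v)ᗮ` (any `v`) leaves `S` invariant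
  have hrefl : ∀ (v : EuclideanSpace ℝ (Fin 3)) (n : ℕ) (x : Fin n → EuclideanSpace ℝ (Fin 3)),
      S n (fun i => (ℝ ∙ v)ᗮ.reflection (x i)) = S n x := by
    intro v n x
    by_cases hv : v = 0
    · have hid : (fun i => (ℝ ∙ v)ᗮ.reflection (x i)) = x := by
        funext i; rw [reflection_orthogonal_span_apply, hv, smul_zero, sub_zero]
      rw [hid]
    · have hvn : 0 < ‖v‖ := norm_pos_iff.2 hv
      set u : EuclideanSpace ℝ (Fin 3) := ‖v‖⁻¹ • v with hu
      have hun : ‖u‖ = 1 := by rw [hu, norm_smul, norm_inv, norm_norm, inv_mul_cancel₀ hvn.ne']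
      have hcfg : (fun i => (ℝ ∙ v)ᗮ.reflection (x i)) = fun i => x i - (2 * ⟪x i, u⟫) • u := by
        funext i
        rw [reflection_orthogonal_span_apply, hu, real_inner_smul_right, smul_smul]
        congr 1
        congr 1
        field_simp
      rw [hcfg]
      exact reflection_invariant htr hsc hinv hsym hnd hun n x
  -- every product of reflections leaves `S` invariant
  have hlist : ∀ (l : List (EuclideanSpace ℝ (Fin 3))) (n : ℕ) (x : Fin n → EuclideanSpace ℝ (Fin 3)),
      S n (fun i => (l.map fun v => (ℝ ∙ v)ᗮ.reflection).prod (x i)) = S n x := by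
    intro l
    induction l with
    | nil => intro n x; simp
    | cons v l ih =>
      intro n x
      rw [List.map_cons, List.prod_cons]
      have e : (fun i => ((ℝ ∙ v)ᗮ.reflection * (l.map fun v => (ℝ ∙ v)ᗮ.reflection).prod) (x i)) =
          fun i => (ℝ ∙ v)ᗮ.reflection ((l.map fun v => (ℝ ∙ v)ᗮ.reflection).prod (x i)) := by
        funext i; rfl
      rw [e, hrefl v n _]
      exact ih n x
  intro n R x
  obtain ⟨l, -, hl⟩ := R.reflections_generate_dim
  rw [hl]
  exact hlist l n x

end Summit.CriticalPhenomena.Ising3DConformalLimit.MoebiusLimitExistsNegative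

end
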